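/-
Copyright: the b2b-balaban T⁴-continuum CRUX team, row NE7b owner lineage `t4-ne7b-p1` (gen 113). Project licence.
-/
import Summits.QuantumFields.BalabanUV.T4Continuum.Spine.NE7b.OneShotChartSupGradient

/-!
# THE ONE-SHOT SECTION IS A BOUNDED OPERATOR ON `ℓ^∞(ℤ^d)` WITH `‖H_M‖ ≤ C_∞(d,a)` AND `‖∇_μ H_M‖ ≤ C_∞(d,a)·M⁻¹`
# FOR EVERY SIDE — HRS's `K₁` AS AN OPERATOR NORM: for the scalar `H = G′Q′*(Q′G′Q′*)⁻¹` of [B5] (1.103) on `ℤ^d`,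
# `d ≥ 3`, the pointwise section `B ↦ H B` of (46) IS a continuous linear map `ℓ^∞ →L[ℝ] ℓ^∞` (Mathlib's `lp · ∞`)
# whose operator norm meets HRS §3's radius letter `|t|·‖H_M‖ < 1` (`t² = M²∕M^d`) for every side `M ≥ M₀(d,a)`
# (row NE7b, node U5c; NL-NE7b-1 limb 1, the literal `K₁`; (46)(47) + Mathlib `lp`, `LinearMap.mkContinuous`; [folklore])

Cell `pub-balaban`, sub-cell `t4`, spine estimate NE7b (`T4WeightBudget.RelWeightBound`; the cell's OWN estimate — NOT PRINTED
in [Bałaban 1983–89], NOT PROVED).  Crux-route work under `Spine/NE7b/` by the row OWNER (`t4-ne7b-p1` gen 113) under FREEZE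
(0)'s crux-prover clause (RULING W-ne7bp1-g113-1, FILING-CLAIM C-ne7bp1-g113-3); NOTHING of Bałaban's is asserted; no
`T4Continuum/Support` leaf typed; no `def` (the operators are delivered as `∃ T, …` with their pointwise action displayed);
zero `sorry`.  Imports (BY NAME): (47) `OneShotChartSupGradient` and through it (46) `OneShotChartSupNorm` (the sup letters
`abs_HBZd_le_sup`, `abs_HBZd_diff_le_sup`, `one_le_supConst`, `radius_letter_eventually`), hence the β-team's
`D1BFx/BlockColumnSupNorm` and the Literature B5 columns; Mathlib's `lp (fun _ : X d => ℝ) ∞` (the Banach space `ℓ^∞(ℤ^d)` with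
`‖B‖ = sup_y |B y|`), `lp.norm_le_of_forall_le`, `LinearMap.mkContinuous(_norm_le)`.

WHY.  HRS (`…HardStepRadiusSupNorm`) reads the radius letter `|t|·K₁ < 1` with `K₁` the sup → sup CONSTANT OF THE CHART SECTION as
an operator between sup-normed spaces; (46) proved the entrywise form `|(HB)(p)| ≤ C_∞·R` for `|B| ≤ R`.  This file packages the
section as the operator the letter quantifies over — linear (the rows are absolutely summable against bounded data, (46)
`summable_HBZd_of_bounded`), bounded by `C_∞ = cHs(d,a)·K_d(δ_H)` — and its forward differences as operators of norm `≤ C_∞·M⁻¹`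
((47) `abs_HBZd_diff_le_sup`), so that `K₁ := ‖H_M‖_{ℓ^∞ → ℓ^∞}` is a literal operator norm meeting HRS's letter for every
large side.  Bookkeeping only.

WHAT IS PROVED ([folklore]; `n : ℕ`, `a > 0`; `ℓ^∞ := lp (fun _ : X d => ℝ) ∞`):
* §1 `abs_apply_le_norm` (`|B y| ≤ ‖B‖`), `HBZd_add`, `HBZd_smul` (every `d`: the section is additive and homogeneous on bounded
  data), `memℓp_HBZd` (`d ≥ 3`: `H B ∈ ℓ^∞`), `memℓp_HBZd_diff` (`d ≥ 3`: `∇_μ(H B) ∈ ℓ^∞`).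
* §2 **`exists_clm_HBZd`** (`d ≥ 3`: `∃ T : ℓ^∞ →L[ℝ] ℓ^∞`, `T B p = (H B)(p)` and `‖T‖ ≤ cHs(d,a)·K_d(δ_H)` — **the section IS a
  bounded operator on `ℓ^∞(ℤ^d)`, norm `≤ C_∞(d,a)`, for EVERY side**), `one_le_norm_of_HBZd` (any such `T` has `1 ≤ ‖T‖`:
  `H·1 = 1`), **`exists_clm_HBZd_diff`** (`d ≥ 3`: `∃ D : ℓ^∞ →L[ℝ] ℓ^∞`, `D B p = (HB)(p+e_μ) − (HB)(p)`, `‖D‖ ≤ C_∞·(n+1)⁻¹`).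
* §3 **`oneShot_radius_letter_opNorm`** (`d ≥ 3`: `∃ M₀, ∀ n, M₀ ≤ n+1 → ∃ T : ℓ^∞ →L[ℝ] ℓ^∞` acting as `H` with
  `|√((n+1)²∕(n+1)^d)|·‖T‖ < 1` — HRS §3's letter with `K₁ := ‖T‖`, the literal operator norm, for every large side).
* §4 toy.

HONEST (what this is NOT).  Constant existential ∕ useless by value (as (46)); scalar `ℤ^d` object, not the torus `Fintype` carrier
of HRS; the `ℓ^∞` currency is NOT a Hilbert currency — the hard-step chain's energy∕coercivity letters (AHE ∕ HSCR ∕ CLSW ∕ OSCE)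
do not transfer to it (HRS l.27 «NOT HERE»), so this `K₁` serves HRS's radius arithmetic only; nothing of (A3) ∕ NC-NE7b-α.
BY-NAME EFFECT ON THE WALL: NONE.  NE7b NOT PRINTED ∕ NOT PROVED; spine PROVED 0∕9; rung (B)+1 on a FINITE torus — NOT infinite
volume, NOT the mass gap, NOT Clay.  HONEST DEPENDENCY: continuum YM on T⁴ ⇐ BetaPertH ∧ nine spine estimates (0∕9 proved);
BetaPertH ⇐ (D1) ∧ (D4) ∧ CAP+tail; G-an2-4 gates asym, D1 and NE2∕3∕4.
-/

set_option autoImplicit false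

namespace Summit.QuantumFields.BalabanUV.T4Continuum.NE7b.OneShotChartSupOperator

open scoped ENNReal
open Literature.MathematicalPhysics.QuantumFieldTheory.Balaban1983to89
open B4Sect5Proof (latticeConst latticeConst_nonneg)
open B6QGQLower276 (X e blk)
open B5Hk103ScalarZd (kerH deltaH deltaH_pos tsum_kerH_row)
open B5Hk165L2Zd (HBZd)
open Summit.QuantumFields.BalabanUV.Beta.D1BFx.BlockColumnSupNorm (cHs cHs_nonneg)
open OneShotChartSupNorm (summable_HBZd_of_bounded abs_HBZd_le_sup one_le_supConst radius_letter_eventually)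
open OneShotChartSupGradient (abs_HBZd_diff_le_sup summable_kerH_row)

noncomputable section

variable {d : ℕ}

/-! ## §1. The section on `ℓ^∞` data: additive, homogeneous, bounded -/

/-- An element of `ℓ^∞(ℤ^d)` is bounded pointwise by its norm: `|B y| ≤ ‖B‖`. [folklore] -/
theorem abs_apply_le_norm (B : lp (fun _ : X d => ℝ) ∞) (y : X d) : |B y| ≤ ‖B‖ := by
  have h := lp.norm_apply_le_norm ENNReal.top_ne_zero B y
  rwa [Real.norm_eq_abs] at h

/-- The section is ADDITIVE on bounded data (every `d`): `H(B₁ + B₂) = HB₁ + HB₂` pointwise. [folklore] -/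
theorem HBZd_add (n : ℕ) {a : ℝ} (ha : 0 < a) {B₁ B₂ : X d → ℝ} {R₁ R₂ : ℝ} (h₁ : ∀ y, |B₁ y| ≤ R₁)
    (h₂ : ∀ y, |B₂ y| ≤ R₂) (p : X d) : HBZd n a (B₁ + B₂) p = HBZd n a B₁ p + HBZd n a B₂ p := by
  rw [HBZd, HBZd, HBZd, ← (summable_HBZd_of_bounded n ha h₁ p).tsum_add (summable_HBZd_of_bounded n ha h₂ p)]
  exact tsum_congr fun y => by rw [Pi.add_apply]; ring

/-- The section is HOMOGENEOUS (every `d`, any data): `H(r•B) = r·HB` pointwise. [folklore] -/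
theorem HBZd_smul (n : ℕ) (a r : ℝ) (B : X d → ℝ) (p : X d) : HBZd n a (r • B) p = r * HBZd n a B p := by
  rw [HBZd, HBZd, ← tsum_mul_left]
  exact tsum_congr fun y => by rw [Pi.smul_apply, smul_eq_mul]; ring

/-- `H B ∈ ℓ^∞` for `B ∈ ℓ^∞` (`d ≥ 3`), with the bound `C_∞·‖B‖`. [folklore] -/
theorem memℓp_HBZd (hd : 3 ≤ d) (n : ℕ) {a : ℝ} (ha : 0 < a) (B : lp (fun _ : X d => ℝ) ∞) :
    Memℓp (fun p => HBZd n a B p) ∞ :=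
  memℓp_infty ⟨cHs d a * latticeConst d (deltaH d a) * ‖B‖, by
    rintro _ ⟨p, rfl⟩
    dsimp only
    rw [Real.norm_eq_abs]
    exact abs_HBZd_le_sup hd n ha (abs_apply_le_norm B) p⟩

/-- `∇_μ(H B) ∈ ℓ^∞` for `B ∈ ℓ^∞` (`d ≥ 3`), with the bound `C_∞·(n+1)⁻¹·‖B‖`. [folklore] -/
theorem memℓp_HBZd_diff (hd : 3 ≤ d) (n : ℕ) {a : ℝ} (ha : 0 < a) (B : lp (fun _ : X d => ℝ) ∞) (μ : Fin d) :
    Memℓp (fun p => HBZd n a B (p + e μ) - HBZd n a B p) ∞ :=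
  memℓp_infty ⟨cHs d a / ((n : ℝ) + 1) * latticeConst d (deltaH d a) * ‖B‖, by
    rintro _ ⟨p, rfl⟩
    dsimp only
    rw [Real.norm_eq_abs]
    exact abs_HBZd_diff_le_sup hd n ha (abs_apply_le_norm B) p μ⟩

/-! ## §2. The operators -/

/-- **THE SECTION IS A BOUNDED OPERATOR ON `ℓ^∞(ℤ^d)`** (`d ≥ 3`): there is `T : ℓ^∞ →L[ℝ] ℓ^∞` with `T B p = (H B)(p)` for all
`B`, `p`, and `‖T‖ ≤ cHs(d,a)·K_d(δ_H)` — for EVERY side `n + 1`, the SAME constant. [folklore] -/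
theorem exists_clm_HBZd (hd : 3 ≤ d) (n : ℕ) {a : ℝ} (ha : 0 < a) :
    ∃ T : lp (fun _ : X d => ℝ) ∞ →L[ℝ] lp (fun _ : X d => ℝ) ∞,
      (∀ (B : lp (fun _ : X d => ℝ) ∞) (p : X d), T B p = HBZd n a B p) ∧
        ‖T‖ ≤ cHs d a * latticeConst d (deltaH d a) := by
  have hC : 0 ≤ cHs d a * latticeConst d (deltaH d a) := zero_le_one.trans (one_le_supConst hd n ha)
  let T₀ : lp (fun _ : X d => ℝ) ∞ → lp (fun _ : X d => ℝ) ∞ := fun B => ⟨fun p => HBZd n a B p, memℓp_HBZd hd n ha B⟩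
  have happ : ∀ (B : lp (fun _ : X d => ℝ) ∞) (p : X d), T₀ B p = HBZd n a B p := fun B p => rfl
  have hadd : ∀ B₁ B₂ : lp (fun _ : X d => ℝ) ∞, T₀ (B₁ + B₂) = T₀ B₁ + T₀ B₂ := by
    intro B₁ B₂
    refine lp.ext (funext fun p => ?_)
    rw [lp.coeFn_add, Pi.add_apply, happ, happ, happ, lp.coeFn_add]
    exact HBZd_add n ha (abs_apply_le_norm B₁) (abs_apply_le_norm B₂) p
  have hsmul : ∀ (r : ℝ) (B : lp (fun _ : X d => ℝ) ∞), T₀ (r • B) = r • T₀ B := by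
    intro r B
    refine lp.ext (funext fun p => ?_)
    rw [lp.coeFn_smul, Pi.smul_apply, happ, happ, lp.coeFn_smul, smul_eq_mul]
    exact HBZd_smul n a r B p
  let Tl : lp (fun _ : X d => ℝ) ∞ →ₗ[ℝ] lp (fun _ : X d => ℝ) ∞ :=
    { toFun := T₀, map_add' := hadd, map_smul' := hsmul }
  have hbd : ∀ B : lp (fun _ : X d => ℝ) ∞, ‖Tl B‖ ≤ cHs d a * latticeConst d (deltaH d a) * ‖B‖ := fun B =>
    lp.norm_le_of_forall_le (mul_nonneg hC (norm_nonneg _)) fun p => by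
      change ‖HBZd n a B p‖ ≤ _
      rw [Real.norm_eq_abs]
      exact abs_HBZd_le_sup hd n ha (abs_apply_le_norm B) p
  exact ⟨Tl.mkContinuous _ hbd, fun B p => rfl, Tl.mkContinuous_norm_le hC hbd⟩

/-- The constant data `1 ∈ ℓ^∞(ℤ^d)`. [folklore] -/
theorem memℓp_one : Memℓp (fun _ : X d => (1 : ℝ)) ∞ :=
  memℓp_infty ⟨1, by rintro _ ⟨y, rfl⟩; simp⟩

/-- **Any operator acting as the section has norm at least one** (every `d`): `H·1 = 1` and `‖1‖_{ℓ^∞} = 1`. [folklore] -/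
theorem one_le_norm_of_HBZd (n : ℕ) {a : ℝ} (ha : 0 < a) (T : lp (fun _ : X d => ℝ) ∞ →L[ℝ] lp (fun _ : X d => ℝ) ∞)
    (hT : ∀ (B : lp (fun _ : X d => ℝ) ∞) (p : X d), T B p = HBZd n a B p) : 1 ≤ ‖T‖ := by
  set one : lp (fun _ : X d => ℝ) ∞ := ⟨fun _ => (1 : ℝ), memℓp_one⟩ with hone
  have h1 : ‖one‖ ≤ 1 := lp.norm_le_of_forall_le zero_le_one fun y => by
    change ‖(1 : ℝ)‖ ≤ 1
    rw [norm_one]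
  have h2 : T one (0 : X d) = 1 := by
    rw [hT]
    change ∑' y : X d, (1 : ℝ) * kerH n a (0 : X d) y = 1
    rw [tsum_congr fun y => one_mul (kerH n a (0 : X d) y), tsum_kerH_row n ha]
  have h3 : (1 : ℝ) ≤ ‖T one‖ := by
    have h := lp.norm_apply_le_norm ENNReal.top_ne_zero (T one) (0 : X d)
    rwa [h2, norm_one] at h
  have h4 : ‖T one‖ ≤ ‖T‖ * ‖one‖ := T.le_opNorm one
  nlinarith [norm_nonneg T]

/-- **THE FORWARD DIFFERENCES OF THE SECTION ARE BOUNDED OPERATORS OF NORM `≤ C_∞·(n+1)⁻¹`** (`d ≥ 3`): for each direction `μ`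
there is `D : ℓ^∞ →L[ℝ] ℓ^∞` with `D B p = (HB)(p+e_μ) − (HB)(p)` and `‖D‖ ≤ cHs(d,a)·(n+1)⁻¹·K_d(δ_H)`. [folklore] -/
theorem exists_clm_HBZd_diff (hd : 3 ≤ d) (n : ℕ) {a : ℝ} (ha : 0 < a) (μ : Fin d) :
    ∃ D : lp (fun _ : X d => ℝ) ∞ →L[ℝ] lp (fun _ : X d => ℝ) ∞,
      (∀ (B : lp (fun _ : X d => ℝ) ∞) (p : X d), D B p = HBZd n a B (p + e μ) - HBZd n a B p) ∧
        ‖D‖ ≤ cHs d a / ((n : ℝ) + 1) * latticeConst d (deltaH d a) := by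
  have hC : 0 ≤ cHs d a / ((n : ℝ) + 1) * latticeConst d (deltaH d a) :=
    mul_nonneg (div_nonneg (cHs_nonneg d ha) (by positivity)) (latticeConst_nonneg d (deltaH_pos d ha).le)
  let D₀ : lp (fun _ : X d => ℝ) ∞ → lp (fun _ : X d => ℝ) ∞ := fun B =>
    ⟨fun p => HBZd n a B (p + e μ) - HBZd n a B p, memℓp_HBZd_diff hd n ha B μ⟩
  have happ : ∀ (B : lp (fun _ : X d => ℝ) ∞) (p : X d), D₀ B p = HBZd n a B (p + e μ) - HBZd n a B p :=
    fun B p => rfl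
  have hadd : ∀ B₁ B₂ : lp (fun _ : X d => ℝ) ∞, D₀ (B₁ + B₂) = D₀ B₁ + D₀ B₂ := by
    intro B₁ B₂
    refine lp.ext (funext fun p => ?_)
    rw [lp.coeFn_add, Pi.add_apply, happ, happ, happ, lp.coeFn_add,
      HBZd_add n ha (abs_apply_le_norm B₁) (abs_apply_le_norm B₂),
      HBZd_add n ha (abs_apply_le_norm B₁) (abs_apply_le_norm B₂)]
    ring
  have hsmul : ∀ (r : ℝ) (B : lp (fun _ : X d => ℝ) ∞), D₀ (r • B) = r • D₀ B := by
    intro r B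
    refine lp.ext (funext fun p => ?_)
    rw [lp.coeFn_smul, Pi.smul_apply, happ, happ, lp.coeFn_smul, smul_eq_mul, HBZd_smul, HBZd_smul]
    ring
  let Dl : lp (fun _ : X d => ℝ) ∞ →ₗ[ℝ] lp (fun _ : X d => ℝ) ∞ :=
    { toFun := D₀, map_add' := hadd, map_smul' := hsmul }
  have hbd : ∀ B : lp (fun _ : X d => ℝ) ∞,
      ‖Dl B‖ ≤ cHs d a / ((n : ℝ) + 1) * latticeConst d (deltaH d a) * ‖B‖ := fun B =>
    lp.norm_le_of_forall_le (mul_nonneg hC (norm_nonneg _)) fun p => by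
      change ‖HBZd n a B (p + e μ) - HBZd n a B p‖ ≤ _
      rw [Real.norm_eq_abs]
      exact abs_HBZd_diff_le_sup hd n ha (abs_apply_le_norm B) p μ
  exact ⟨Dl.mkContinuous _ hbd, fun B p => rfl, Dl.mkContinuous_norm_le hC hbd⟩

/-! ## §3. HRS's letter with `K₁` the operator norm -/

/-- **THE RADIUS LETTER WITH `K₁ := ‖H_M‖_{ℓ^∞ → ℓ^∞}`** (`d ≥ 3`): there is a side `M₀` such that for every side `n + 1 ≥ M₀` the
section at that side is an operator `T : ℓ^∞ →L[ℝ] ℓ^∞` whose norm meets HRS §3's letter `|√((n+1)²∕(n+1)^d)|·‖T‖ < 1`. [folklore] -/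
theorem oneShot_radius_letter_opNorm (hd : 3 ≤ d) {a : ℝ} (ha : 0 < a) :
    ∃ M₀ : ℕ, ∀ n : ℕ, M₀ ≤ n + 1 →
      ∃ T : lp (fun _ : X d => ℝ) ∞ →L[ℝ] lp (fun _ : X d => ℝ) ∞,
        (∀ (B : lp (fun _ : X d => ℝ) ∞) (p : X d), T B p = HBZd n a B p) ∧
          |Real.sqrt ((((n : ℝ) + 1)) ^ 2 / (((n : ℝ) + 1)) ^ d)| * ‖T‖ < 1 := by
  have hC : 0 ≤ cHs d a * latticeConst d (deltaH d a) := zero_le_one.trans (one_le_supConst hd 0 ha)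
  obtain ⟨M₀, hM₀⟩ := radius_letter_eventually hC hd
  refine ⟨M₀, fun n hn => ?_⟩
  obtain ⟨T, hT, hnorm⟩ := exists_clm_HBZd hd n ha
  refine ⟨T, hT, ?_⟩
  have h := hM₀ (n + 1) hn
  push_cast at h
  exact lt_of_le_of_lt (mul_le_mul_of_nonneg_left hnorm (abs_nonneg _)) h

/-! ## §4. Toy -/

/-- Toy: the radius arithmetic with an operator norm — if `‖T‖ ≤ 5∕2` then at d = 4, side `M = 4` (`|t| = 1∕4`) the letter holds. -/
example (K : ℝ) (hK : K ≤ 5 / 2) : |(1 / 4 : ℝ)| * K < 1 := by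
  rw [abs_of_pos (by norm_num : (0 : ℝ) < 1 / 4)]
  linarith

end

end Summit.QuantumFields.BalabanUV.T4Continuum.NE7b.OneShotChartSupOperator
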